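import Summits.Ventures.HodgeRepro2.T5DiscreteCocompactDecomposition
import Summits.Ventures.HodgeRepro2.T5CocompactInversion

/-!
# T5ComponentDecomposition — [DE] Theorem 9.2.2 on every component `Γ_i\G_∞` of STEP 1

Cell pub-hodge-repro2, seat p5, Tier 5 (route/T5-N4-p5.md, N4.3 v13 (A3) STEP 1 – STEP 2 and
(B2)).  STEP 1 (rows 39 / 40 on p2's `T5DoubleCosetDecomposition`) identifies
`[G]/K_f = ⊔_i Γ_i\G_∞` with `Γ_i = gammaGroup H K (rep q)` DISCRETE in `G_∞ = A`
(`discreteTopology_gammaGroup`) and `A ⧸ Γ_i` COMPACT (`compactSpace_quotient_gammaGroup`) when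
`[G] = FullQuotient H K` is compact and `K = K_f` is compact open.  (B2) then applies [DE]
Theorem 9.2.2 to each `Γ_i`.  Row 65 (`T5DiscreteCocompactDecomposition`) holds that theorem with
the printed hypotheses; this file closes the loop:

* `isMulRightInvariant_of_component`: `G_∞ = A` is UNIMODULAR (row 64 = [DE] Prop. 9.1.2 on any
  component `Γ_q`; `FiniteQuotient H K` is nonempty);
* `exists_decomposition_component`: **for every component `q` and every left Haar measure `μ`
  on `A`, `L²(A ⧸ Γ_q, μ_𝓕)` is the closed orthogonal sum of irreducible closed `A`-stable
  subspaces with every unitary-equivalence class FINITE** — the sentence «hence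
  `L²(Γ_i\G_∞) ≅ ⊕_π N_{Γ_i}(π)·π` with every `N_{Γ_i}(π)` FINITE» of N4.3 (B2), in kernel on
  STEP 1's own `Γ_i`, with no hypothesis beyond STEP 1's (`H` discrete in `A × B`, `K` compact
  open, `FullQuotient H K` compact, `A` locally compact second countable Hausdorff, `B` Hausdorff).

Imports rows 39 / 40 / 65 (nothing re-declared).  Axioms: propext, Classical.choice, Quot.sound.
README §8(d): uses an L-value-free non-vanishing device: NO.
-/

namespace Summit.Ventures.HodgeRepro2.T5ComponentDecomposition

open MeasureTheory
open Summit.Ventures.HodgeRepro2.T5DoubleCosetDecomposition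
open Summit.Ventures.HodgeRepro2.T5CocompactInversion
open Summit.Ventures.HodgeRepro2.T5DiscreteCocompactDecomposition
open Summit.Ventures.HodgeRepro2.T5RegularRep (regularRep)
open Summit.Ventures.HodgeRepro2.T5FiniteMultiplicity (IsUnitaryEquiv)
open Summit.Ventures.HodgeRepro2.T5CompactDiscreteDecomposition (IrreducibleOn)

variable {A B : Type*} [Group A] [Group B] (H : Subgroup (A × B)) (K : Subgroup B)
  [TopologicalSpace A] [TopologicalSpace B] [IsTopologicalGroup A] [T2Space A]
  [LocallyCompactSpace A] [SecondCountableTopology A] [IsTopologicalGroup B] [T2Space B]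
  [DiscreteTopology H] [CompactSpace (FullQuotient H K)]

include H in
/-- **`G_∞ = A` is unimodular**: it has the discrete cocompact subgroup `Γ_q` of any component
`q` (row 64 = [DE] Prop. 9.1.2), so every left Haar measure on `A` is right-invariant. -/
theorem isMulRightInvariant_of_component [MeasurableSpace A] [BorelSpace A]
    (hKc : IsCompact (K : Set B)) (hKo : IsOpen (K : Set B)) (μ : Measure A) [μ.IsHaarMeasure] :
    μ.IsMulRightInvariant :=
  let q : FiniteQuotient H K := Classical.arbitrary _
  haveI := discreteTopology_gammaGroup H K hKc (rep q)
  haveI := compactSpace_quotient_gammaGroup H K hKo q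
  T5CocompactUnimodular.isMulRightInvariant_of_discrete_cocompact (gammaGroup H K (rep q)) μ

attribute [-instance] Quotient.instMeasurableSpace

/-- **[DE] Theorem 9.2.2 on every component of STEP 1**: for `q : FiniteQuotient H K`,
`Γ_q = gammaGroup H K (rep q)` and any left Haar measure `μ` on `A = G_∞`, there is a Borel
fundamental domain `𝓕` of `Γ_q.op` whose quotient measure `μ_𝓕` on `A ⧸ Γ_q` is finite and
`A`-invariant, and `L²(A ⧸ Γ_q, μ_𝓕)` is the closed orthogonal sum of irreducible closed
`A`-stable subspaces, every unitary-equivalence class of which is FINITE. -/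
theorem exists_decomposition_component [MeasurableSpace A] [BorelSpace A]
    (hKc : IsCompact (K : Set B)) (hKo : IsOpen (K : Set B)) (q : FiniteQuotient H K)
    [MeasurableSpace (A ⧸ gammaGroup H K (rep q))] [BorelSpace (A ⧸ gammaGroup H K (rep q))]
    (μ : Measure A) [μ.IsHaarMeasure] :
    ∃ 𝓕 : Set A, MeasurableSet 𝓕 ∧ IsFundamentalDomain (gammaGroup H K (rep q)).op 𝓕 μ ∧
      IsFiniteMeasure (Measure.map (QuotientGroup.mk : A → A ⧸ gammaGroup H K (rep q))
        (μ.restrict 𝓕)) ∧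
      ∃ _ : SMulInvariantMeasure A (A ⧸ gammaGroup H K (rep q))
          (Measure.map (QuotientGroup.mk : A → A ⧸ gammaGroup H K (rep q)) (μ.restrict 𝓕)),
      ∃ S : Set (Submodule ℂ (Lp ℂ 2
          (Measure.map (QuotientGroup.mk : A → A ⧸ gammaGroup H K (rep q)) (μ.restrict 𝓕)))),
        (∀ U ∈ S, IrreducibleOn (regularRep (G := A)
          (Measure.map (QuotientGroup.mk : A → A ⧸ gammaGroup H K (rep q)) (μ.restrict 𝓕))) U) ∧
        S.Pairwise (fun U V => U ⟂ V) ∧ (sSup S).topologicalClosure = ⊤ ∧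
        ∀ U₀ ∈ S, {U ∈ S | IsUnitaryEquiv (regularRep (G := A)
          (Measure.map (QuotientGroup.mk : A → A ⧸ gammaGroup H K (rep q)) (μ.restrict 𝓕)))
            U₀ U}.Finite :=
  haveI := discreteTopology_gammaGroup H K hKc (rep q)
  haveI := compactSpace_quotient_gammaGroup H K hKo q
  exists_decomposition_of_discrete_cocompact (gammaGroup H K (rep q)) μ

end Summit.Ventures.HodgeRepro2.T5ComponentDecomposition
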